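import Literature.Analysis.FluidPDE.PassiveScalarClassicalWeak
import Literature.Analysis.FluidPDE.PassiveScalarForced

/-!
# Negative knowledge for the crux `ScalarAnomalySteadySourceFormal` (stmt-AnomalousDissipation-0448), II:
# classical forced scalar solutions are weak forced solutions

Certified copy of §3.1 of the cdisprove work file
`Cruxes/ScalarAnomalySteadySourceFormal/Disproof.lean`: a classical (jointly smooth) solution of
`∂ₜθ + u·∇θ = κΔθ + s`, `div u = 0` on a time set `S ⊇ [0,T]` is a weak solution of the FORCED
equation in the crux's class `Torus.IsWeakScalarTransportForcedOn` (every dimension `d`) — the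
forced twin of `Torus.IsClassicalScalarTransportOn.isWeakScalarTransportOn_holds`
(DiPerna–Lions 1989, §II.1 (12)–(14) with right-hand side; Evans 2010, §7.1.1 (b)).  It is the
support lemma `ClassicalForcedScalarIsWeak` that the crux cards (orbit riding, Green–Kubo) lean on,
and the entry point of every explicit model of the crux's clauses (work file §3–§4).
Supports stmt-AnomalousDissipation-0448.
-/

set_option linter.dupNamespace false

noncomputable section

open scoped Topology ENNReal NNReal InnerProductSpace ContDiff
open Filter Set MeasureTheory

namespace Summit.AnomalousDissipation.AnomalousDissipation.Theorems.ScalarAnomalySteadySourceFormal.Negative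

open Literature.Analysis
open Literature.Analysis.FunctionSpaces Literature.Analysis.FunctionSpaces.Torus
open Literature.Analysis.FluidPDE Literature.Analysis.FluidPDE.Torus

section ForcedClassicalWeak

variable {d : Type*} [Fintype d] [DecidableEq d]

/-- **Classical forced solutions are weak forced solutions** (the support lemma
`ClassicalForcedScalarIsWeak` asked for by the crux cards, PROVED): a classical (jointly smooth)
solution of `∂ₜθ + u·∇θ = κΔθ + s`, `div u = 0`, on a time set `S ⊇ [0, T]` is a weak solution
of the forced equation on `T^d × [0, T)` with datum `θ 0` (`IsWeakScalarTransportForcedOn`):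
multiply by a test function, integrate by parts on `T^d` and in `t` — the proof of the unforced
`IsClassicalScalarTransportOn.isWeakScalarTransportOn_holds` with the source pairing
`∫₀ᵀ ∫ s ψ` carried along (DiPerna–Lions 1989, §II.1 (12)–(14) with right-hand side; Evans 2010,
§7.1.1 (b)). [cite: DiPernaLions1989, §II.1 (12)–(14)] -/
theorem isWeakScalarTransportForcedOn_of_classical {S : Set ℝ} {κ T : ℝ}
    {u : ℝ → UnitAddTorus d → EuclideanSpace ℝ d} {s θ : ℝ → UnitAddTorus d → ℝ}
    (h : IsClassicalScalarTransportForcedOn S κ u s θ) (hS : Icc 0 T ⊆ S) :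
    IsWeakScalarTransportForcedOn T κ u s (θ 0) θ := by
  have hu : FunctionSpaces.Torus.IsSmoothSpaceTimeOn S u := h.smooth_velocity
  have hθ : FunctionSpaces.Torus.IsSmoothSpaceTimeOn S θ := h.smooth_scalar
  have hs : FunctionSpaces.Torus.IsSmoothSpaceTimeOn S s := h.smooth_source
  have hIoo_S : Ioo 0 T ⊆ S := Ioo_subset_Icc_self.trans hS
  -- uniform bounds on the compact `[0, T] × T^d`
  obtain ⟨Cθ, hCθ⟩ := hθ.exists_norm_le_of_isCompact isCompact_Icc hS
  obtain ⟨Cu, hCu⟩ := hu.exists_norm_le_of_isCompact isCompact_Icc hS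
  obtain ⟨Cs, hCs⟩ := hs.exists_norm_le_of_isCompact isCompact_Icc hS
  have hbθ : ∀ t ∈ Ioo 0 T, ∀ x, ‖θ t x‖ₑ ≤ (Cθ.toNNReal : ℝ≥0∞) := fun t ht x => by
    rw [← ofReal_norm]
    exact ENNReal.ofReal_le_ofReal (hCθ t (Ioo_subset_Icc_self ht) x)
  have hbu : ∀ t ∈ Ioo 0 T, ∀ x, ‖u t x‖ₑ ≤ (Cu.toNNReal : ℝ≥0∞) := fun t ht x => by
    rw [← ofReal_norm]
    exact ENNReal.ofReal_le_ofReal (hCu t (Ioo_subset_Icc_self ht) x)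
  have hbs : ∀ t ∈ Ioo 0 T, ∀ x, ‖s t x‖ₑ ≤ (Cs.toNNReal : ℝ≥0∞) := fun t ht x => by
    rw [← ofReal_norm]
    exact ENNReal.ofReal_le_ofReal (hCs t (Ioo_subset_Icc_self ht) x)
  have hvol : volume (Ioo (0 : ℝ) T) < ⊤ := by
    rw [Real.volume_Ioo]; exact ENNReal.ofReal_lt_top
  have hu2 : ∀ t ∈ Ioo 0 T, ∫⁻ x, ‖u t x‖ₑ ^ 2 ≤ (Cu.toNNReal : ℝ≥0∞) ^ 2 := fun t ht =>
    calc ∫⁻ x, ‖u t x‖ₑ ^ 2 ≤ ∫⁻ _, (Cu.toNNReal : ℝ≥0∞) ^ 2 :=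
          lintegral_mono fun x => by gcongr; exact hbu t ht x
      _ = (Cu.toNNReal : ℝ≥0∞) ^ 2 := by rw [lintegral_const, measure_univ, mul_one]
  refine ⟨?_, ?_, ?_, ?_, ?_, ?_, ?_, ?_, ?_⟩
  -- (1)–(3) measurability on `(0,T) × ℝ^d`
  · exact hθ.aestronglyMeasurable_stLift measurableSet_Ioo hIoo_S
  · exact hu.aestronglyMeasurable_stLift measurableSet_Ioo hIoo_S
  · exact hs.aestronglyMeasurable_stLift measurableSet_Ioo hIoo_S
  -- (4) `θ ∈ L^∞(0,T; L²)`
  · refine ⟨Cθ.toNNReal ^ 2, (ae_restrict_iff' measurableSet_Ioo).2 (ae_of_all _ fun t ht => ?_)⟩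
    calc ∫⁻ x, ‖θ t x‖ₑ ^ 2 ≤ ∫⁻ _, (Cθ.toNNReal : ℝ≥0∞) ^ 2 :=
          lintegral_mono fun x => by gcongr; exact hbθ t ht x
      _ = ((Cθ.toNNReal ^ 2 : ℝ≥0) : ℝ≥0∞) := by
          rw [lintegral_const, measure_univ, mul_one, ENNReal.coe_pow]
  -- (5) `u ∈ L¹(0,T; L²)`
  · calc ∫⁻ t in Ioo 0 T, (∫⁻ x, ‖u t x‖ₑ ^ 2) ^ (1 / 2 : ℝ)
        ≤ ∫⁻ _ in Ioo 0 T, ((Cu.toNNReal : ℝ≥0∞) ^ 2) ^ (1 / 2 : ℝ) :=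
          setLIntegral_mono' measurableSet_Ioo fun t ht =>
            ENNReal.rpow_le_rpow (hu2 t ht) (by norm_num)
      _ = ((Cu.toNNReal : ℝ≥0∞) ^ 2) ^ (1 / 2 : ℝ) * volume (Ioo (0 : ℝ) T) :=
          setLIntegral_const _ _
      _ < ⊤ := ENNReal.mul_lt_top (ENNReal.rpow_lt_top_of_nonneg (by norm_num)
          (ENNReal.pow_ne_top ENNReal.coe_ne_top)) hvol
  -- (6) `u θ ∈ L¹((0,T) × T^d)`
  · calc ∫⁻ t in Ioo 0 T, ∫⁻ x, ‖u t x‖ₑ * ‖θ t x‖ₑ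
        ≤ ∫⁻ _ in Ioo 0 T, (Cu.toNNReal : ℝ≥0∞) * Cθ.toNNReal :=
          setLIntegral_mono' measurableSet_Ioo fun t ht =>
            calc ∫⁻ x, ‖u t x‖ₑ * ‖θ t x‖ₑ ≤ ∫⁻ _, (Cu.toNNReal : ℝ≥0∞) * Cθ.toNNReal :=
                  lintegral_mono fun x => mul_le_mul' (hbu t ht x) (hbθ t ht x)
              _ = (Cu.toNNReal : ℝ≥0∞) * Cθ.toNNReal := by
                  rw [lintegral_const, measure_univ, mul_one]
      _ = (Cu.toNNReal : ℝ≥0∞) * Cθ.toNNReal * volume (Ioo (0 : ℝ) T) := setLIntegral_const _ _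
      _ < ⊤ := ENNReal.mul_lt_top (ENNReal.mul_lt_top ENNReal.coe_lt_top ENNReal.coe_lt_top) hvol
  -- (7) `s ∈ L¹((0,T) × T^d)`
  · calc ∫⁻ t in Ioo 0 T, ∫⁻ x, ‖s t x‖ₑ
        ≤ ∫⁻ _ in Ioo 0 T, (Cs.toNNReal : ℝ≥0∞) :=
          setLIntegral_mono' measurableSet_Ioo fun t ht =>
            calc ∫⁻ x, ‖s t x‖ₑ ≤ ∫⁻ _, (Cs.toNNReal : ℝ≥0∞) := lintegral_mono fun x => hbs t ht x
              _ = (Cs.toNNReal : ℝ≥0∞) := by rw [lintegral_const, measure_univ, mul_one]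
      _ = (Cs.toNNReal : ℝ≥0∞) * volume (Ioo (0 : ℝ) T) := setLIntegral_const _ _
      _ < ⊤ := ENNReal.mul_lt_top ENNReal.coe_lt_top hvol
  -- (8) `u(t)` is weakly divergence free for every `t ∈ (0,T)`
  · refine (ae_restrict_iff' measurableSet_Ioo).2 (ae_of_all _ fun t ht => ?_)
    exact (h.divFree t (hIoo_S ht)).isWeaklyDivFree_holds (hu.isSmooth_slice (hIoo_S ht))
  -- (9) the weak identity with datum and source
  · intro ψ hψ
    obtain ⟨hψs, T', hT'T, hT'⟩ := id hψ
    rcases le_or_gt T 0 with hT | hT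
    · rw [Ioo_eq_empty (not_lt.2 hT), Measure.restrict_empty, integral_zero_measure,
        integral_zero_measure, hT' 0 (hT'T.le.trans hT)]
      simp
    set I : Set ℝ := Icc 0 T with hI_def
    have hIS : I ⊆ S := hS
    have hU : UniqueDiffOn ℝ I := uniqueDiffOn_Icc hT
    have hθI : FunctionSpaces.Torus.IsSmoothSpaceTimeOn I θ := hθ.mono hIS
    have hsI : FunctionSpaces.Torus.IsSmoothSpaceTimeOn I s := hs.mono hIS
    have hψI : FunctionSpaces.Torus.IsSmoothSpaceTimeOn I ψ := hψs.contDiffOn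
    have hg : FunctionSpaces.Torus.IsSmoothSpaceTimeOn I (fun t x => θ t x * ψ t x) := hθI.mul hψI
    have hsψ : FunctionSpaces.Torus.IsSmoothSpaceTimeOn I (fun t x => s t x * ψ t x) := hsI.mul hψI
    set E : ℝ → ℝ := fun t => ∫ x, θ t x * ψ t x with hE_def
    set E' : ℝ → ℝ := fun t => ∫ x, FunctionSpaces.Torus.timeDerivWithin I (fun t x => θ t x * ψ t x) t x
      with hE'_def
    set B : ℝ → ℝ := fun t => ∫ x, s t x * ψ t x with hB_def
    have hE : ∀ t ∈ I, HasDerivWithinAt E (E' t) I t := fun t ht =>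
      hg.hasDerivWithinAt_integral (convex_Icc 0 T) ht
    have hE'cont : ContinuousOn E' I := hg.continuousOn_integral_timeDerivWithin hU
    have hBcont : ContinuousOn B I := hsψ.continuousOn_integral (convex_Icc 0 T)
    have hE'int : IntegrableOn E' (Ioo 0 T) volume :=
      (hE'cont.integrableOn_compact isCompact_Icc).mono_set Ioo_subset_Icc_self
    have hBint : IntegrableOn B (Ioo 0 T) volume :=
      (hBcont.integrableOn_compact isCompact_Icc).mono_set Ioo_subset_Icc_self
    -- `∫₀ᵀ E' = E(T) - E(0) = -∫ θ 0 ψ 0`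
    have hET : E T = 0 := by
      simp only [hE_def, hT' T hT'T.le, Pi.zero_apply, mul_zero, integral_zero]
    have hFTC : ∫ t in Ioo 0 T, E' t = E T - E 0 := by
      rw [← integral_Ioc_eq_integral_Ioo, ← intervalIntegral.integral_of_le hT.le,
        intervalIntegral.integral_eq_sub_of_hasDerivAt_of_le hT.le
          (fun t ht => (hE t ht).continuousWithinAt)
          (fun t ht => (hE t (Ioo_subset_Icc_self ht)).hasDerivAt (Icc_mem_nhds ht.1 ht.2))
          ((hE'cont.mono (uIcc_of_le hT.le).subset).intervalIntegrable)]
    -- it suffices to identify the integrand with `E' - B` on `(0, T)`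
    suffices hkey : ∫ t in Ioo 0 T, ∫ x, θ t x *
        (FunctionSpaces.Torus.timeDeriv ψ t x + ⟪u t x, FunctionSpaces.Torus.gradient (ψ t) x⟫_ℝ +
          κ * FunctionSpaces.Torus.laplacian (ψ t) x) =
        ∫ t in Ioo 0 T, (E' t - B t) by
      rw [hkey, integral_sub hE'int hBint, hFTC, hET, zero_sub, hE_def]
      ring
    refine setIntegral_congr_fun measurableSet_Ioo fun t ht => ?_
    have htS : t ∈ S := hIoo_S ht
    have htI : t ∈ I := Ioo_subset_Icc_self ht
    have hut : FunctionSpaces.Torus.IsSmooth (u t) := hu.isSmooth_slice htS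
    have hθt : FunctionSpaces.Torus.IsSmooth (θ t) := hθ.isSmooth_slice htS
    have hst : FunctionSpaces.Torus.IsSmooth (s t) := hs.isSmooth_slice htS
    have hψt : FunctionSpaces.Torus.IsSmooth (ψ t) := hψI.isSmooth_slice htI
    have hψ't : FunctionSpaces.Torus.IsSmooth (FunctionSpaces.Torus.timeDeriv ψ t) :=
      hψ.timeDeriv.isSmooth_slice t
    have hI_nhds : I ∈ 𝓝 t := Icc_mem_nhds ht.1 ht.2
    have hS_nhds : S ∈ 𝓝 t := mem_of_superset hI_nhds hIS
    have hAeq : ∀ x, FunctionSpaces.Torus.timeDerivWithin I θ t x =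
        FunctionSpaces.Torus.timeDerivWithin S θ t x := fun x => by
      rw [FunctionSpaces.Torus.timeDerivWithin, FunctionSpaces.Torus.timeDerivWithin,
        derivWithin_of_mem_nhds hI_nhds, derivWithin_of_mem_nhds hS_nhds]
    -- the equation, solved for `∂ₜθ`
    have h3 : ∀ x, FunctionSpaces.Torus.timeDerivWithin S θ t x =
        κ * FunctionSpaces.Torus.laplacian (θ t) x + s t x -
          ⟪u t x, FunctionSpaces.Torus.gradient (θ t) x⟫_ℝ := fun x => by
      rw [eq_sub_iff_add_eq]
      exact h.transport t htS x
    -- pointwise: `∂ₜ(θψ) = (κΔθ + s - u·∇θ) ψ + θ ∂ₜψ` on `(0,T)`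
    have hslice : ∀ x, FunctionSpaces.Torus.timeDerivWithin I (fun t x => θ t x * ψ t x) t x =
        (κ * FunctionSpaces.Torus.laplacian (θ t) x + s t x -
            ⟪u t x, FunctionSpaces.Torus.gradient (θ t) x⟫_ℝ) * ψ t x +
          θ t x * FunctionSpaces.Torus.timeDeriv ψ t x := by
      intro x
      have h1 : HasDerivWithinAt (fun τ => θ τ x) (FunctionSpaces.Torus.timeDerivWithin S θ t x) I t := by
        have h' := hθI.hasDerivWithinAt_slice htI x
        rwa [hAeq x] at h'
      have h2 : HasDerivWithinAt (fun τ => ψ τ x) (FunctionSpaces.Torus.timeDeriv ψ t x) I t := by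
        obtain ⟨y, rfl⟩ := FunctionSpaces.Torus.proj_surjective x
        have hd : Differentiable ℝ (fun τ : ℝ => FunctionSpaces.Torus.stLift ψ (τ, y)) :=
          (hψs.differentiable (by simp)).comp (differentiable_id.prodMk (differentiable_const y))
        exact (hd t).hasDerivAt.hasDerivWithinAt
      have h12 := (h1.fun_mul h2).derivWithin (hU t htI)
      rw [FunctionSpaces.Torus.timeDerivWithin, h12, h3]
    -- integrability of the pieces
    have iA : Integrable (fun x => θ t x * FunctionSpaces.Torus.timeDeriv ψ t x) volume :=
      (hθt.smul' hψ't).integrable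
    have iB : Integrable (fun x => θ t x * ⟪u t x, FunctionSpaces.Torus.gradient (ψ t) x⟫_ℝ) volume :=
      (hθt.smul' (hut.inner hψt.gradient)).integrable
    have iB' : Integrable (fun x => ⟪u t x, FunctionSpaces.Torus.gradient (θ t) x⟫_ℝ * ψ t x) volume :=
      ((hut.inner hθt.gradient).smul' hψt).integrable
    have iC : Integrable (fun x => κ * (θ t x * FunctionSpaces.Torus.laplacian (ψ t) x)) volume :=
      (hθt.smul' hψt.laplacian).integrable.const_mul κ
    have iC' : Integrable (fun x => κ * (FunctionSpaces.Torus.laplacian (θ t) x * ψ t x)) volume :=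
      (hθt.laplacian.smul' hψt).integrable.const_mul κ
    have iS : Integrable (fun x => s t x * ψ t x) volume := (hst.smul' hψt).integrable
    have iAB : Integrable (fun x => θ t x * FunctionSpaces.Torus.timeDeriv ψ t x +
        θ t x * ⟪u t x, FunctionSpaces.Torus.gradient (ψ t) x⟫_ℝ) volume := iA.add iB
    have iC'B' : Integrable (fun x => κ * (FunctionSpaces.Torus.laplacian (θ t) x * ψ t x) -
        ⟪u t x, FunctionSpaces.Torus.gradient (θ t) x⟫_ℝ * ψ t x) volume := iC'.sub iB'
    have iC'B'A : Integrable (fun x => κ * (FunctionSpaces.Torus.laplacian (θ t) x * ψ t x) -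
        ⟪u t x, FunctionSpaces.Torus.gradient (θ t) x⟫_ℝ * ψ t x +
          θ t x * FunctionSpaces.Torus.timeDeriv ψ t x) volume := iC'B'.add iA
    -- the two integrations by parts on the torus
    have hB := integral_mul_inner_gradient_add_eq_zero hut (h.divFree t htS) hθt hψt
    have hC : ∫ x, κ * (θ t x * FunctionSpaces.Torus.laplacian (ψ t) x) =
        ∫ x, κ * (FunctionSpaces.Torus.laplacian (θ t) x * ψ t x) := by
      rw [integral_const_mul, integral_const_mul,
        FunctionSpaces.Torus.integral_mul_laplacian_comm_holds hθt hψt]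
    have hL : (fun x => θ t x *
        (FunctionSpaces.Torus.timeDeriv ψ t x + ⟪u t x, FunctionSpaces.Torus.gradient (ψ t) x⟫_ℝ +
          κ * FunctionSpaces.Torus.laplacian (ψ t) x)) =
        fun x => θ t x * FunctionSpaces.Torus.timeDeriv ψ t x +
          θ t x * ⟪u t x, FunctionSpaces.Torus.gradient (ψ t) x⟫_ℝ +
            κ * (θ t x * FunctionSpaces.Torus.laplacian (ψ t) x) := funext fun x => by ring
    have hR : (fun x => FunctionSpaces.Torus.timeDerivWithin I (fun t x => θ t x * ψ t x) t x) =
        fun x => κ * (FunctionSpaces.Torus.laplacian (θ t) x * ψ t x) -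
          ⟪u t x, FunctionSpaces.Torus.gradient (θ t) x⟫_ℝ * ψ t x +
            θ t x * FunctionSpaces.Torus.timeDeriv ψ t x + s t x * ψ t x :=
      funext fun x => by rw [hslice x]; ring
    simp only [hE'_def, hB_def]
    rw [hL, hR, integral_add iAB iC, integral_add iA iB, integral_add iC'B'A iS,
      integral_add iC'B' iA, integral_sub iC' iB', hC]
    linarith

/-- The global version: a classical forced solution on all of `ℝ × T^d` is a global weak forced
solution with datum `θ 0`. [cite: DiPernaLions1989, §II.1 (12)–(14)] -/
theorem isWeakScalarTransportForced_of_classical {κ : ℝ}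
    {u : ℝ → UnitAddTorus d → EuclideanSpace ℝ d} {s θ : ℝ → UnitAddTorus d → ℝ}
    (h : IsClassicalScalarTransportForcedOn univ κ u s θ) :
    IsWeakScalarTransportForced κ u s (θ 0) θ :=
  fun _ _ => isWeakScalarTransportForcedOn_of_classical h (subset_univ _)

end ForcedClassicalWeak

end Summit.AnomalousDissipation.AnomalousDissipation.Theorems.ScalarAnomalySteadySourceFormal.Negative
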